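import Summits.Ventures.LatticeQCDFlow.Scoring.SU2TorusPlaquetteSquareCharacterIntegral
import Summits.Ventures.LatticeQCDFlow.Scoring.SU2TorusPolyakovLoops
import HarnessLib

/-!
# SU(2) on the 2-torus: THE EXACT SECOND MOMENT OF THE PLAQUETTE `⟨(½ tr U_p)²⟩_{(ℤ/L)², β}`

HONEST FRAMING: exact (Metropolis-corrected) sampling algorithms for lattice gauge theory;
figures of merit are autocorrelation/cost numbers at stated couplings and volumes; no
continuum-physics claim.

Venture `LatticeQCDFlow` (cell pub-lqcd), sub-topic `Scoring`; FANOUT row 5 (`s0-sun-a`), GEN-12.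
NEW WORK of the cell (placement rule).  GEN-10's `SU2TorusPlaquette` typed the exact torus plaquette
`⟨½ tr U_p⟩`; this file types its exact SECOND MOMENT — hence the exact variance of a single plaquette
under theory-2's Wilson measure, the first ingredient of the error-bar oracle `Var(P̄)` behind the S0
acceptance test 'plaquette within 2σ of exact'.  With `c_n(β) = e^{−2β}(I_n(2β) − I_{n+2}(2β))`
(`c_n/(n+1) = λ_n = e^{−2β} I_{n+1}(2β)/β`):

* `hasSum_integral_su2a0_sq_mul_exp_neg_wilsonAction_two` — from the twice-inserted character integral
  (`SU2TorusPlaquetteSquareCharacterIntegral`) only three families of assignments survive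
  (`x ≡ n+2` off `x₀` with `x_{x₀} = n`; `x ≡ n`; `x ≡ n` off `x₀` with `x_{x₀} = n+2`):
  `∫ a₀(U_{x₀})² e^{−βS} dHaar^{⊗E} = ¼ Σ_n [c_n c_{n+2}^{L²−1}/(n+3)^{L²} + (1+[n≠0]) c_n^{L²}/(n+1)^{L²}
  + c_{n+2} c_n^{L²−1}/(n+1)^{L²}]`;
* **`wilson_mean_su2a0_sq_plaquette_two`** — THE EXACT SECOND MOMENT: for every `L ≥ 1`, `β ≥ 0`, `x₀`:
  `⟨(½ tr U_{x₀})²⟩_{(ℤ/L)²,β} = ¼ Σ_n [c_n c_{n+2}^{L²−1}/(n+3)^{L²} + (1+[n≠0]) c_n^{L²}/(n+1)^{L²}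
  + c_{n+2} c_n^{L²−1}/(n+1)^{L²}] / Σ_n (c_n/(n+1))^{L²}`; as `L → ∞` the `n = 0` terms dominate and
  the ratio tends to `¼(1 + c_2/c_0) = ¼(1 + 3 I₃(2β)/I₁(2β))` (`= ∫ (½ tr U)² e^{β tr U} dU / ∫ e^{β tr U} dU`,
  the one-plaquette second moment: `(½ tr)² = ¼(χ_2 + χ_0)`).

Nothing is cited; no `def`.
-/

noncomputable section

open Real MeasureTheory Set Function Finset Polynomial.Chebyshev
open Literature.MathematicalPhysics.QuantumFieldTheory Literature.MathematicalPhysics.QuantumLattice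
open Literature.Analysis.FunctionSpaces
open Summit.Ventures.LatticeQCDFlow.Exactness
open Summit.Ventures.LatticeQCDFlow.Theory2.Lattice

namespace Summit.Ventures.LatticeQCDFlow.Scoring

variable {L : ℕ} [NeZero L]

/-! ## §1. The expansion term -/

/-- `∏_{p} c n = c_n^{L²}` on the plaquettes of `(ℤ/L)²`. -/
theorem prod_const_plaquette_two (c : ℕ → ℝ) (n : ℕ) :
    ∏ _p : Plaquette 2 L, c n = c n ^ (L ^ 2) := by
  rw [Finset.prod_const, Finset.card_univ]
  congr 1
  let e : Plaquette 2 L ≃ Site 2 L :=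
    { toFun := fun p => p.1
      invFun := fun x => (x, ⟨((0 : Fin 2), (1 : Fin 2)), by decide⟩)
      left_inv := fun p => (plaquette_two_eq p).symm
      right_inv := fun _ => rfl }
  rw [Fintype.card_congr e, Flux.card_site_two]

omit [NeZero L] in
/-- The squared plaquette trace is continuous in the configuration. -/
theorem continuous_su2a0_sq_plaquette (x₀ : Site 2 L) :
    Continuous fun V : GaugeConfig 2 L (Matrix.specialUnitaryGroup (Fin 2) ℂ) =>
      su2a0 (plaquetteHolonomy V x₀ 0 1) * su2a0 (plaquetteHolonomy V x₀ 0 1) := by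
  have h : Continuous fun V : GaugeConfig 2 L (Matrix.specialUnitaryGroup (Fin 2) ℂ) =>
      su2a0 (plaquetteHolonomy V x₀ 0 1) :=
    continuous_su2a0.comp (by unfold plaquetteHolonomy; fun_prop)
  exact h.mul h

/-- **The expansion term of the squared insertion**: for `x : plaquettes → ℕ` with base-site assignment
`m`, `(∏_p c_{x_p}) ∫ a₀(U_{x₀})² ∏_p χ_{x_p}(U_p) = (∏_p c_{x_p})·(¼ I(m⁺⁺) + ¼(1+[m_{x₀}≠0]) I(m) + ¼[m_{x₀}≥2] I(m⁻⁻))`. -/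
theorem sq_insertion_term_two (β : ℝ) (x₀ : Site 2 L) (x : Plaquette 2 L → ℕ) :
    (∏ p, Real.exp (-(2 * β)) * (besselI (x p) (2 * β) - besselI (x p + 2) (2 * β))) *
        ∫ V, su2a0 (plaquetteHolonomy V x₀ 0 1) * su2a0 (plaquetteHolonomy V x₀ 0 1) *
          ∏ p : Plaquette 2 L, (U ℝ (x p)).eval (su2a0 (plaquetteHolonomy V p.1 p.2.1.1 p.2.1.2))
          ∂(Measure.pi fun _ : Edge 2 L => haarProbability (Matrix.specialUnitaryGroup (Fin 2) ℂ)) =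
      (∏ p, Real.exp (-(2 * β)) * (besselI (x p) (2 * β) - besselI (x p + 2) (2 * β))) *
        ((1 / 4) * (if (∀ s : Site 2 L,
              update (fun s : Site 2 L => x (s, ⟨((0 : Fin 2), (1 : Fin 2)), by decide⟩)) x₀
                  (x (x₀, ⟨((0 : Fin 2), (1 : Fin 2)), by decide⟩) + 2) s =
                update (fun s : Site 2 L => x (s, ⟨((0 : Fin 2), (1 : Fin 2)), by decide⟩)) x₀
                  (x (x₀, ⟨((0 : Fin 2), (1 : Fin 2)), by decide⟩) + 2) 0) then
            ((((update (fun s : Site 2 L => x (s, ⟨((0 : Fin 2), (1 : Fin 2)), by decide⟩)) x₀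
                (x (x₀, ⟨((0 : Fin 2), (1 : Fin 2)), by decide⟩) + 2) 0 : ℕ) : ℝ) + 1) ^ (L ^ 2))⁻¹ else 0) +
          (1 / 4) * (if x (x₀, ⟨((0 : Fin 2), (1 : Fin 2)), by decide⟩) = 0 then 1 else 2) *
            (if (∀ s : Site 2 L, x (s, ⟨((0 : Fin 2), (1 : Fin 2)), by decide⟩) =
                x ((0 : Site 2 L), ⟨((0 : Fin 2), (1 : Fin 2)), by decide⟩)) then
              ((((x ((0 : Site 2 L), ⟨((0 : Fin 2), (1 : Fin 2)), by decide⟩) : ℕ) : ℝ) + 1) ^ (L ^ 2))⁻¹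
              else 0) +
          (1 / 4) * (if x (x₀, ⟨((0 : Fin 2), (1 : Fin 2)), by decide⟩) < 2 then 0 else
            if (∀ s : Site 2 L,
                update (fun s : Site 2 L => x (s, ⟨((0 : Fin 2), (1 : Fin 2)), by decide⟩)) x₀
                    (x (x₀, ⟨((0 : Fin 2), (1 : Fin 2)), by decide⟩) - 2) s =
                  update (fun s : Site 2 L => x (s, ⟨((0 : Fin 2), (1 : Fin 2)), by decide⟩)) x₀
                    (x (x₀, ⟨((0 : Fin 2), (1 : Fin 2)), by decide⟩) - 2) 0) then
              ((((update (fun s : Site 2 L => x (s, ⟨((0 : Fin 2), (1 : Fin 2)), by decide⟩)) x₀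
                  (x (x₀, ⟨((0 : Fin 2), (1 : Fin 2)), by decide⟩) - 2) 0 : ℕ) : ℝ) + 1) ^ (L ^ 2))⁻¹ else 0)) := by
  congr 1
  have hint : (fun V : GaugeConfig 2 L (Matrix.specialUnitaryGroup (Fin 2) ℂ) =>
      su2a0 (plaquetteHolonomy V x₀ 0 1) * su2a0 (plaquetteHolonomy V x₀ 0 1) *
        ∏ p : Plaquette 2 L, (U ℝ (x p)).eval (su2a0 (plaquetteHolonomy V p.1 p.2.1.1 p.2.1.2))) =
      fun V => su2a0 (plaquetteHolonomy V x₀ 0 1) * (su2a0 (plaquetteHolonomy V x₀ 0 1) *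
        ∏ s : Site 2 L, (U ℝ ((fun s : Site 2 L => x (s, ⟨((0 : Fin 2), (1 : Fin 2)), by decide⟩)) s)).eval
          (su2a0 (plaquetteHolonomy V s 0 1))) := by
    funext V
    rw [prod_plaquette_two, mul_assoc]
  rw [hint, integral_su2a0_sq_mul_prod_su2Character_plaquettes]

/-! ## §2. The squared insertion as a series over `ℕ` -/

/-- **`∫ a₀(U_{x₀})² e^{−βS} dHaar^{⊗E} = ¼ Σ_n [c_n c_{n+2}^{L²−1}/(n+3)^{L²} + (1+[n≠0]) c_n^{L²}/(n+1)^{L²}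
+ c_{n+2} c_n^{L²−1}/(n+1)^{L²}]`** (`β ≥ 0`, `L ≥ 1`, `c_n = e^{−2β}(I_n(2β) − I_{n+2}(2β))`), as a `HasSum`. -/
theorem hasSum_integral_su2a0_sq_mul_exp_neg_wilsonAction_two {β : ℝ} (hβ : 0 ≤ β) (x₀ : Site 2 L) :
    HasSum (fun n : ℕ => (1 / 4) *
        ((Real.exp (-(2 * β)) * (besselI n (2 * β) - besselI (n + 2) (2 * β))) *
            (Real.exp (-(2 * β)) * (besselI (n + 2) (2 * β) - besselI (n + 2 + 2) (2 * β))) ^ (L ^ 2 - 1) *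
            ((((n : ℝ) + 2 + 1) ^ (L ^ 2)))⁻¹ +
          (if n = 0 then 1 else 2) *
            (Real.exp (-(2 * β)) * (besselI n (2 * β) - besselI (n + 2) (2 * β))) ^ (L ^ 2) *
            ((((n : ℝ) + 1) ^ (L ^ 2)))⁻¹ +
          (Real.exp (-(2 * β)) * (besselI (n + 2) (2 * β) - besselI (n + 2 + 2) (2 * β))) *
            (Real.exp (-(2 * β)) * (besselI n (2 * β) - besselI (n + 2) (2 * β))) ^ (L ^ 2 - 1) *
            ((((n : ℝ) + 1) ^ (L ^ 2)))⁻¹))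
      (∫ V, su2a0 (plaquetteHolonomy V x₀ 0 1) * su2a0 (plaquetteHolonomy V x₀ 0 1) *
          Real.exp (-β * wilsonAction (fundamentalRep (Fin 2)) V)
        ∂(Measure.pi fun _ : Edge 2 L => haarProbability (Matrix.specialUnitaryGroup (Fin 2) ℂ))) := by
  haveI := secondCountableTopology_su2
  obtain ⟨hsum, hN⟩ := integral_obs_mul_exp_neg_wilsonAction_eq_tsum (L := L) hβ
    (fun V : GaugeConfig 2 L (Matrix.specialUnitaryGroup (Fin 2) ℂ) =>
      su2a0 (plaquetteHolonomy V x₀ 0 1) * su2a0 (plaquetteHolonomy V x₀ 0 1))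
    (continuous_su2a0_sq_plaquette x₀).measurable
    (fun V => by
      rw [abs_mul]
      exact mul_le_one₀ (abs_su2a0_le_one _) (abs_nonneg _) (abs_su2a0_le_one _))
  -- abbreviations: the plane, the observed plaquette, the coefficients
  set pl : {p : Fin 2 × Fin 2 // p.1 < p.2} := ⟨((0 : Fin 2), (1 : Fin 2)), by decide⟩ with hpl
  set p₀ : Plaquette 2 L := (x₀, pl) with hp₀
  set c : ℕ → ℝ := fun n => Real.exp (-(2 * β)) * (besselI n (2 * β) - besselI (n + 2) (2 * β)) with hc
  have hc0 : ∀ n, 0 ≤ c n := fun n => charCoeff_nonneg hβ n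
  -- the three surviving families of terms
  set Tp : (Plaquette 2 L → ℕ) → ℝ := fun x => (∏ p, c (x p)) * ((1 / 4) *
    (if (∀ s : Site 2 L, update (fun s : Site 2 L => x (s, pl)) x₀ (x p₀ + 2) s =
        update (fun s : Site 2 L => x (s, pl)) x₀ (x p₀ + 2) 0) then
      ((((update (fun s : Site 2 L => x (s, pl)) x₀ (x p₀ + 2) 0 : ℝ) + 1) ^ (L ^ 2)))⁻¹ else 0)) with hTp
  set T0 : (Plaquette 2 L → ℕ) → ℝ := fun x => (∏ p, c (x p)) * ((1 / 4) *
    (if x p₀ = 0 then 1 else 2) *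
    (if (∀ s : Site 2 L, x (s, pl) = x ((0 : Site 2 L), pl)) then
      ((((x ((0 : Site 2 L), pl) : ℕ) : ℝ) + 1) ^ (L ^ 2))⁻¹ else 0)) with hT0
  set Tm : (Plaquette 2 L → ℕ) → ℝ := fun x => (∏ p, c (x p)) * ((1 / 4) *
    (if x p₀ < 2 then 0 else
      if (∀ s : Site 2 L, update (fun s : Site 2 L => x (s, pl)) x₀ (x p₀ - 2) s =
          update (fun s : Site 2 L => x (s, pl)) x₀ (x p₀ - 2) 0) then
        ((((update (fun s : Site 2 L => x (s, pl)) x₀ (x p₀ - 2) 0 : ℝ) + 1) ^ (L ^ 2)))⁻¹ else 0)) with hTm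
  have hT : ∀ x : Plaquette 2 L → ℕ,
      (∏ p, Real.exp (-(2 * β)) * (besselI (x p) (2 * β) - besselI (x p + 2) (2 * β))) *
      ∫ V, su2a0 (plaquetteHolonomy V x₀ 0 1) * su2a0 (plaquetteHolonomy V x₀ 0 1) *
        ∏ p : Plaquette 2 L, (U ℝ (x p)).eval (su2a0 (plaquetteHolonomy V p.1 p.2.1.1 p.2.1.2))
        ∂(Measure.pi fun _ : Edge 2 L => haarProbability (Matrix.specialUnitaryGroup (Fin 2) ℂ)) =
      Tp x + T0 x + Tm x := by
    intro x
    rw [sq_insertion_term_two β x₀ x, hTp, hT0, hTm, hc]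
    simp only
    ring
  simp_rw [hT] at hsum hN
  have hprod0 : ∀ x : Plaquette 2 L → ℕ, 0 ≤ ∏ p, c (x p) := fun x => Finset.prod_nonneg fun p _ => hc0 _
  have hTp0 : ∀ x, 0 ≤ Tp x := by
    intro x
    rw [hTp]
    refine mul_nonneg (hprod0 x) (mul_nonneg (by norm_num) ?_)
    split_ifs <;> positivity
  have hT00 : ∀ x, 0 ≤ T0 x := by
    intro x
    rw [hT0]
    refine mul_nonneg (hprod0 x) (mul_nonneg (mul_nonneg (by norm_num) ?_) ?_)
    · split_ifs <;> norm_num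
    · split_ifs <;> positivity
  have hTm0 : ∀ x, 0 ≤ Tm x := by
    intro x
    rw [hTm]
    refine mul_nonneg (hprod0 x) (mul_nonneg (by norm_num) ?_)
    split_ifs <;> positivity
  have hTps : Summable Tp :=
    Summable.of_nonneg_of_le hTp0 (fun x => by linarith [hT00 x, hTm0 x]) hsum
  have hT0s : Summable T0 :=
    Summable.of_nonneg_of_le hT00 (fun x => by linarith [hTp0 x, hTm0 x]) hsum
  have hTms : Summable Tm :=
    Summable.of_nonneg_of_le hTm0 (fun x => by linarith [hTp0 x, hT00 x]) hsum
  -- the surviving assignments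
  set g₁ : ℕ → (Plaquette 2 L → ℕ) := fun n => update (fun _ => n + 2) p₀ n with hg₁
  set g₀ : ℕ → (Plaquette 2 L → ℕ) := fun n => fun _ => n with hg₀
  set g₂ : ℕ → (Plaquette 2 L → ℕ) := fun n => update (fun _ => n) p₀ (n + 2) with hg₂
  have hg₁inj : Injective g₁ := fun n n' h => by
    have := congrFun h p₀
    simpa [hg₁] using this
  have hg₀inj : Injective g₀ := fun n n' h => by
    have := congrFun h p₀
    simpa [hg₀] using this
  have hg₂inj : Injective g₂ := fun n n' h => by
    have := congrFun h p₀
    simpa [hg₂] using this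
  -- a plaquette other than `p₀` has base site `≠ x₀`
  have hbase : ∀ p : Plaquette 2 L, p ≠ p₀ → p.1 ≠ x₀ := by
    intro p hp h1
    exact hp (by rw [plaquette_two_eq p, h1])
  have hsuppTp : support Tp ⊆ Set.range g₁ := by
    intro x hx
    rw [mem_support, hTp] at hx
    simp only at hx
    have hcst : ∀ s : Site 2 L, update (fun s : Site 2 L => x (s, pl)) x₀ (x p₀ + 2) s =
        update (fun s : Site 2 L => x (s, pl)) x₀ (x p₀ + 2) 0 := by
      by_contra h
      rw [if_neg h, mul_zero, mul_zero] at hx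
      exact hx rfl
    refine ⟨x p₀, funext fun p => ?_⟩
    by_cases hp : p = p₀
    · rw [hp, hg₁]
      simp
    · rw [hg₁]
      simp only [update_of_ne hp]
      have h1 := hcst p.1
      rw [update_of_ne (hbase p hp), ← hcst x₀, update_self] at h1
      rw [plaquette_two_eq p]
      exact h1.symm
  have hsuppT0 : support T0 ⊆ Set.range g₀ := by
    intro x hx
    rw [mem_support, hT0] at hx
    simp only at hx
    have hcst : ∀ s : Site 2 L, x (s, pl) = x ((0 : Site 2 L), pl) := by
      by_contra h
      rw [if_neg h, mul_zero, mul_zero] at hx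
      exact hx rfl
    refine ⟨x p₀, funext fun p => ?_⟩
    rw [hg₀]
    simp only
    rw [plaquette_two_eq p, hcst p.1, hp₀, ← hcst x₀]
  have hsuppTm : support Tm ⊆ Set.range g₂ := by
    intro x hx
    rw [mem_support, hTm] at hx
    simp only at hx
    have h2 : ¬ x p₀ < 2 := by
      intro h
      rw [if_pos h, mul_zero, mul_zero] at hx
      exact hx rfl
    rw [if_neg h2] at hx
    have hcst : ∀ s : Site 2 L, update (fun s : Site 2 L => x (s, pl)) x₀ (x p₀ - 2) s =
        update (fun s : Site 2 L => x (s, pl)) x₀ (x p₀ - 2) 0 := by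
      by_contra h
      rw [if_neg h, mul_zero, mul_zero] at hx
      exact hx rfl
    refine ⟨x p₀ - 2, funext fun p => ?_⟩
    by_cases hp : p = p₀
    · rw [hp, hg₂]
      simp only [update_self]
      omega
    · rw [hg₂]
      simp only [update_of_ne hp]
      have h1 := hcst p.1
      rw [update_of_ne (hbase p hp), ← hcst x₀, update_self] at h1
      rw [plaquette_two_eq p]
      exact h1.symm
  -- the values on the surviving assignments
  have hup₁ : ∀ n : ℕ, update (fun s : Site 2 L => g₁ n (s, pl)) x₀ (g₁ n p₀ + 2) =
      fun _ => n + 2 := by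
    intro n
    funext s
    by_cases hs : s = x₀
    · rw [hs, update_self, hg₁]
      simp
    · rw [update_of_ne hs, hg₁]
      have : ((s, pl) : Plaquette 2 L) ≠ p₀ := fun h => hs (congrArg Prod.fst h)
      simp [update_of_ne this]
  have hup₂ : ∀ n : ℕ, update (fun s : Site 2 L => g₂ n (s, pl)) x₀ (g₂ n p₀ - 2) =
      fun _ => n := by
    intro n
    funext s
    by_cases hs : s = x₀
    · rw [hs, update_self, hg₂]
      simp
    · rw [update_of_ne hs, hg₂]
      have : ((s, pl) : Plaquette 2 L) ≠ p₀ := fun h => hs (congrArg Prod.fst h)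
      simp [update_of_ne this]
  have hTpg : ∀ n : ℕ, Tp (g₁ n) = (1 / 4) * (c n * c (n + 2) ^ (L ^ 2 - 1) *
      ((((n : ℝ) + 2 + 1) ^ (L ^ 2)))⁻¹) := by
    intro n
    rw [hTp]
    simp only
    rw [hup₁ n, if_pos (fun _ => rfl), hg₁, prod_update_const]
    push_cast
    ring
  have hT0g : ∀ n : ℕ, T0 (g₀ n) = (1 / 4) * ((if n = 0 then 1 else 2) * c n ^ (L ^ 2) *
      ((((n : ℝ) + 1) ^ (L ^ 2)))⁻¹) := by
    intro n
    rw [hT0]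
    simp only
    rw [if_pos (fun _ => rfl), hg₀, prod_const_plaquette_two]
    ring
  have hTmg : ∀ n : ℕ, Tm (g₂ n) = (1 / 4) * (c (n + 2) * c n ^ (L ^ 2 - 1) *
      ((((n : ℝ) + 1) ^ (L ^ 2)))⁻¹) := by
    intro n
    rw [hTm]
    simp only
    have hne : ¬ g₂ n p₀ < 2 := by rw [hg₂]; simp
    rw [if_neg hne, hup₂ n, if_pos (fun _ => rfl), hg₂, prod_update_const]
    ring
  -- assemble
  have h1 : HasSum (Tp ∘ g₁) (∑' x, Tp x) := by
    rw [← hg₁inj.tsum_eq hsuppTp]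
    exact (hTps.comp_injective hg₁inj).hasSum
  have h0 : HasSum (T0 ∘ g₀) (∑' x, T0 x) := by
    rw [← hg₀inj.tsum_eq hsuppT0]
    exact (hT0s.comp_injective hg₀inj).hasSum
  have h2 : HasSum (Tm ∘ g₂) (∑' x, Tm x) := by
    rw [← hg₂inj.tsum_eq hsuppTm]
    exact (hTms.comp_injective hg₂inj).hasSum
  have h12 := (h1.add h0).add h2
  rw [← hTps.tsum_add hT0s, ← (hTps.add hT0s).tsum_add hTms, ← hN] at h12
  refine h12.congr_fun fun n => ?_
  simp only [Function.comp_apply, hTpg, hT0g, hTmg, hc]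
  ring

/-- **`∫ a₀(U_{x₀})² e^{−βS} dHaar^{⊗E}`** as the series (`β ≥ 0`, `L ≥ 1`). -/
theorem integral_su2a0_sq_mul_exp_neg_wilsonAction_two {β : ℝ} (hβ : 0 ≤ β) (x₀ : Site 2 L) :
    ∫ V, su2a0 (plaquetteHolonomy V x₀ 0 1) * su2a0 (plaquetteHolonomy V x₀ 0 1) *
          Real.exp (-β * wilsonAction (fundamentalRep (Fin 2)) V)
        ∂(Measure.pi fun _ : Edge 2 L => haarProbability (Matrix.specialUnitaryGroup (Fin 2) ℂ)) =
      ∑' n : ℕ, (1 / 4) *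
        ((Real.exp (-(2 * β)) * (besselI n (2 * β) - besselI (n + 2) (2 * β))) *
            (Real.exp (-(2 * β)) * (besselI (n + 2) (2 * β) - besselI (n + 2 + 2) (2 * β))) ^ (L ^ 2 - 1) *
            ((((n : ℝ) + 2 + 1) ^ (L ^ 2)))⁻¹ +
          (if n = 0 then 1 else 2) *
            (Real.exp (-(2 * β)) * (besselI n (2 * β) - besselI (n + 2) (2 * β))) ^ (L ^ 2) *
            ((((n : ℝ) + 1) ^ (L ^ 2)))⁻¹ +
          (Real.exp (-(2 * β)) * (besselI (n + 2) (2 * β) - besselI (n + 2 + 2) (2 * β))) *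
            (Real.exp (-(2 * β)) * (besselI n (2 * β) - besselI (n + 2) (2 * β))) ^ (L ^ 2 - 1) *
            ((((n : ℝ) + 1) ^ (L ^ 2)))⁻¹) :=
  (hasSum_integral_su2a0_sq_mul_exp_neg_wilsonAction_two hβ x₀).tsum_eq.symm

/-! ## §3. The exact second moment of the torus plaquette -/

/-- **THE EXACT SECOND MOMENT OF THE SU(2) PLAQUETTE ON THE 2-TORUS.**  For every `L ≥ 1`, `β ≥ 0` and
plaquette `x₀` of `(ℤ/L)²`, under theory-2's Wilson measure `wilsonMeasure (fundamentalRep (Fin 2)) β`: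
`⟨(½ tr U_{x₀})²⟩ = ¼ Σ_n [c_n c_{n+2}^{L²−1}/(n+3)^{L²} + (1+[n≠0]) c_n^{L²}/(n+1)^{L²} + c_{n+2} c_n^{L²−1}/(n+1)^{L²}]
/ Σ_n (c_n/(n+1))^{L²}`, `c_n = e^{−2β}(I_n(2β) − I_{n+2}(2β))`. -/
theorem wilson_mean_su2a0_sq_plaquette_two {β : ℝ} (hβ : 0 ≤ β) (x₀ : Site 2 L) :
    ∫ V, su2a0 (plaquetteHolonomy V x₀ 0 1) * su2a0 (plaquetteHolonomy V x₀ 0 1)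
        ∂(wilsonMeasure (d := 2) (L := L) (fundamentalRep (Fin 2)) β) =
      (∑' n : ℕ, (1 / 4) *
        ((Real.exp (-(2 * β)) * (besselI n (2 * β) - besselI (n + 2) (2 * β))) *
            (Real.exp (-(2 * β)) * (besselI (n + 2) (2 * β) - besselI (n + 2 + 2) (2 * β))) ^ (L ^ 2 - 1) *
            ((((n : ℝ) + 2 + 1) ^ (L ^ 2)))⁻¹ +
          (if n = 0 then 1 else 2) *
            (Real.exp (-(2 * β)) * (besselI n (2 * β) - besselI (n + 2) (2 * β))) ^ (L ^ 2) *
            ((((n : ℝ) + 1) ^ (L ^ 2)))⁻¹ +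
          (Real.exp (-(2 * β)) * (besselI (n + 2) (2 * β) - besselI (n + 2 + 2) (2 * β))) *
            (Real.exp (-(2 * β)) * (besselI n (2 * β) - besselI (n + 2) (2 * β))) ^ (L ^ 2 - 1) *
            ((((n : ℝ) + 1) ^ (L ^ 2)))⁻¹)) /
      ∑' n : ℕ, (Real.exp (-(2 * β)) * (besselI n (2 * β) - besselI (n + 2) (2 * β)) /
        ((n : ℝ) + 1)) ^ (L ^ 2) := by
  rw [integral_wilsonMeasure_su2_eq_div, integral_su2a0_sq_mul_exp_neg_wilsonAction_two hβ,
    partitionFunction_su2_two_toReal_eq_tsum hβ]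

end Summit.Ventures.LatticeQCDFlow.Scoring
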